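import Literature.Computability.Cryptography.WordRAMStructuredBlocks
import HarnessLib

/-!
# The word RAM — small verified routines: powers, the word size, constant tables, the output word

Structured routines (`SProg`, `Literature.Computability.Cryptography.WordRAMStructured`) over the
`merge R H` register convention (registers at literal addresses `< 100`, data above), each with
an exact execution certificate:

* `powLoop X E Y` — `Y := X ^ E` by repeated multiplication (`powLoop_exec`: `4 E + 2` steps,
  provided `X ^ E < 2 ^ w`);
* `probeWidth X W` — `W := w`, the word size, found by doubling `1` until it wraps to `0`
  (`probeWidth_exec`: `4 w + 3` steps) — a program must know `w` to decide how much memory it may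
  address (the dispatch of exponential-memory algorithms such as Pratt's, STOC 2024, Thm. 1.9);
* `writeConsts P vs` — write the literal words `vs` at the data address held in `P`, advancing
  `P` (`writeConsts_exec`: `2 |vs|` steps) — how a program lays out its constant tables;
* `output1 A` — make the output the one-word list `[R A]` (`output1_exec`, `readOut_output1`).

[folklore] engineering (Nipkow–Klein, *Concrete Semantics*, §12, total-correctness rules).

## References

* T. Nipkow, G. Klein, *Concrete Semantics with Isabelle/HOL*, Springer 2014, §7, §12.
* T. Hagerup, *Sorting and searching on the word RAM*, STACS 1998, §2.
-/

namespace Literature.Computability.Cryptography.WordRAM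

/-- Addition below the word size, with the sum named. [folklore] -/
theorem BinOp.eval_add_eq {w x y v : ℕ} (hv : x + y = v) (h : v < 2 ^ w) : BinOp.add.eval w x y = v := by
  rw [BinOp.eval_add_of_lt (hv ▸ h), hv]

/-- Subtraction of a smaller word, with the difference named. [folklore] -/
theorem BinOp.eval_sub_eq {w x y v : ℕ} (hyx : y ≤ x) (hx : x < 2 ^ w) (hv : x - y = v) :
    BinOp.sub.eval w x y = v := by
  rw [BinOp.eval_sub_of_le hyx hx, hv]

/-- Multiplication below the word size, with the product named. [folklore] -/
theorem BinOp.eval_mul_eq {w x y v : ℕ} (hv : x * y = v) (h : v < 2 ^ w) : BinOp.mul.eval w x y = v := by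
  rw [BinOp.eval_mul_of_lt (hv ▸ h), hv]

namespace SProg

variable {w : ℕ} {O : List ℕ → List ℕ}

/-- Equality of stores with merged memories from equality of the two parts. [folklore] -/
theorem store_merge_eq {S S' H H' : ℕ → ℕ} {qs : List (List ℕ)} (hS : S = S') (hH : H = H') :
    (⟨merge S H, qs⟩ : Store) = ⟨merge S' H', qs⟩ := by rw [hS, hH]

/-! ## Powers -/

/-- `Y := X ^ E` (registers `X, E, Y < 100`, pairwise distinct): `Y := 1; while E ≠ 0 { Y := Y * X;
E := E - 1 }`. [folklore] -/
def powLoop (X E Y : ℕ) : SProg :=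
  seq (op .add (.dir Y) (.imm 1) (.imm 0))
    (whilenz (.dir E) (seq (op .mul (.dir Y) (.dir Y) (.dir X)) (op .sub (.dir E) (.dir E) (.imm 1))))

/-- `powLoop` makes no oracle query. [folklore] -/
theorem powLoop_queryFree (X E Y : ℕ) : (powLoop X E Y).QueryFree := by
  simp [powLoop, QueryFree]

/-- Registers during `powLoop`: after `i` iterations `Y = x ^ i`, `E = e - i`. [folklore] -/
def powR (R : ℕ → ℕ) (E Y x e i : ℕ) : ℕ → ℕ :=
  Function.update (Function.update R Y (x ^ i)) E (e - i)

/-- Register `Y` during `powLoop`. [folklore] -/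
theorem powR_Y (R : ℕ → ℕ) {E Y : ℕ} (hEY : E ≠ Y) (x e i : ℕ) : powR R E Y x e i Y = x ^ i := by
  simp [powR, hEY.symm]

/-- Register `E` during `powLoop`. [folklore] -/
theorem powR_E (R : ℕ → ℕ) (E Y x e i : ℕ) : powR R E Y x e i E = e - i := by
  simp [powR]

/-- The other registers during `powLoop`. [folklore] -/
theorem powR_of_ne (R : ℕ → ℕ) {E Y : ℕ} (x e i : ℕ) {a : ℕ} (haE : a ≠ E) (haY : a ≠ Y) :
    powR R E Y x e i a = R a := by
  simp [powR, haE, haY]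

/-- **Semantics of `powLoop`.** With `x` in `X` and `e` in `E` and `x ^ e < 2 ^ w` (`w ≥ 1`),
`powLoop X E Y` ends after exactly `4 e + 2` steps with `x ^ e` in `Y`, `0` in `E`, all other
registers and the data unchanged. [folklore] -/
theorem powLoop_exec {X E Y : ℕ} (hX : X < 100) (hE : E < 100) (hY : Y < 100) (hXY : X ≠ Y)
    (hEY : E ≠ Y) (hXE : X ≠ E) {R H : ℕ → ℕ} {x e : ℕ} (hx : R X = x) (he : R E = e)
    (hw : 1 ≤ w) (hpow : x ^ e < 2 ^ w) (hew : e < 2 ^ w) (qs : List (List ℕ)) :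
    Exec w O (powLoop X E Y) ⟨merge R H, qs⟩ ⟨merge (powR R E Y x e e) H, qs⟩ (4 * e + 2) := by
  have h1w : 1 < 2 ^ w := Nat.one_lt_two_pow (by omega)
  -- `Y := 1`
  have hR0 : Function.update R Y 1 = powR R E Y x e 0 := by
    funext a
    by_cases haE : a = E
    · subst haE
      rw [Function.update_of_ne hEY, powR_E, he, Nat.sub_zero]
    · by_cases haY : a = Y
      · subst haY; rw [Function.update_self, powR_Y R hEY, pow_zero]
      · rw [Function.update_of_ne haY, powR_of_ne R x e 0 haE haY]
  have hinit : Exec w O (op .add (.dir Y) (.imm 1) (.imm 0)) ⟨merge R H, qs⟩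
      ⟨merge (powR R E Y x e 0) H, qs⟩ 1 := by
    have := Exec.op_dir' (w := w) (O := O) hY (o := .add) (x := .imm 1) (y := .imm 0) (S := R)
      (H := H) (qs := qs) (v := 1) (BinOp.eval_add_eq rfl h1w)
    rwa [hR0] at this
  -- one iteration
  have hxpow : ∀ i, i < e → x ^ (i + 1) < 2 ^ w := by
    intro i hi
    rcases Nat.eq_zero_or_pos x with rfl | hx0
    · rw [zero_pow (by omega)]; omega
    · exact lt_of_le_of_lt (Nat.pow_le_pow_right hx0 hi) hpow
  have hbody : ∀ i, i < e → Exec w O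
      (seq (op .mul (.dir Y) (.dir Y) (.dir X)) (op .sub (.dir E) (.dir E) (.imm 1)))
      ⟨merge (powR R E Y x e i) H, qs⟩ ⟨merge (powR R E Y x e (i + 1)) H, qs⟩ (1 + 1) := by
    intro i hi
    refine Exec.seq (Exec.op_dir' hY (v := x ^ (i + 1)) ?_)
      ((Exec.op_dir' hE (v := e - (i + 1)) ?_).of_eq (store_merge_eq ?_ rfl))
    · rw [Operand.read_dir, Operand.read_dir, merge_apply_of_lt hY, merge_apply_of_lt hX,
        powR_Y R hEY, powR_of_ne R x e i hXE hXY, hx]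
      exact BinOp.eval_mul_eq (pow_succ x i).symm (hxpow i hi)
    · rw [Operand.read_dir, Operand.read_imm, merge_apply_of_lt hE, Function.update_of_ne hEY,
        powR_E]
      exact BinOp.eval_sub_eq (by omega) (by omega) (by omega)
    · funext a
      simp only [powR, Function.update_apply]
      split_ifs <;> rfl
  have hloop := Exec.whilenz_iter (w := w) (O := O) (x := .dir E)
    (s := seq (op .mul (.dir Y) (.dir Y) (.dir X)) (op .sub (.dir E) (.dir E) (.imm 1))) e
    (fun i => ⟨merge (powR R E Y x e i) H, qs⟩) (fun _ => 1 + 1)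
    (fun i hi => by
      show (Operand.dir E).read (merge (powR R E Y x e i) H) ≠ 0
      rw [Operand.read_dir_merge hE, powR_E]; omega)
    (by
      show (Operand.dir E).read (merge (powR R E Y x e e) H) = 0
      rw [Operand.read_dir_merge hE, powR_E, Nat.sub_self])
    hbody
  have ht : 4 * e + 2 = 1 + (1 + ∑ i ∈ Finset.range e, (1 + 1 + 2)) := by
    rw [Finset.sum_const, Finset.card_range, smul_eq_mul]; omega
  rw [ht]
  exact Exec.seq hinit hloop

/-! ## The word size -/

/-- `W := w` by doubling: `X := 1; W := 0; while X ≠ 0 { X := X + X; W := W + 1 }` (the word `1`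
doubled `w` times wraps to `0`). [folklore] -/
def probeWidth (X W : ℕ) : SProg :=
  seq (seq (op .add (.dir X) (.imm 1) (.imm 0)) (op .add (.dir W) (.imm 0) (.imm 0)))
    (whilenz (.dir X) (seq (op .add (.dir X) (.dir X) (.dir X)) (op .add (.dir W) (.dir W) (.imm 1))))

/-- `probeWidth` makes no oracle query. [folklore] -/
theorem probeWidth_queryFree (X W : ℕ) : (probeWidth X W).QueryFree := by
  simp [probeWidth, QueryFree]

/-- Registers during `probeWidth`: after `i ≤ w` iterations `X = 2 ^ i mod 2 ^ w`, `W = i`. [folklore] -/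
def probeR (R : ℕ → ℕ) (X W i : ℕ) (w : ℕ) : ℕ → ℕ :=
  Function.update (Function.update R X (2 ^ i % 2 ^ w)) W i

/-- Register `X` during `probeWidth`. [folklore] -/
theorem probeR_X (R : ℕ → ℕ) {X W : ℕ} (hXW : X ≠ W) (i w : ℕ) : probeR R X W i w X = 2 ^ i % 2 ^ w := by
  simp [probeR, hXW]

/-- Register `W` during `probeWidth`. [folklore] -/
theorem probeR_W (R : ℕ → ℕ) (X W i w : ℕ) : probeR R X W i w W = i := by
  simp [probeR]

/-- The other registers during `probeWidth`. [folklore] -/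
theorem probeR_of_ne (R : ℕ → ℕ) {X W : ℕ} (i w : ℕ) {a : ℕ} (haX : a ≠ X) (haW : a ≠ W) :
    probeR R X W i w a = R a := by
  simp [probeR, haX, haW]

/-- **Semantics of `probeWidth`.** For `w ≥ 1`, `probeWidth X W` ends after exactly `4 w + 3`
steps with `w` in `W` and `0` in `X`, everything else unchanged. [folklore] -/
theorem probeWidth_exec {X W : ℕ} (hX : X < 100) (hW : W < 100) (hXW : X ≠ W) (R H : ℕ → ℕ)
    (hw : 1 ≤ w) (qs : List (List ℕ)) :
    Exec w O (probeWidth X W) ⟨merge R H, qs⟩ ⟨merge (probeR R X W w w) H, qs⟩ (4 * w + 3) := by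
  have h1w : 1 < 2 ^ w := Nat.one_lt_two_pow (by omega)
  have hww : w < 2 ^ w := Nat.lt_two_pow_self
  have hpow : ∀ i, i < w → 2 ^ i < 2 ^ w := fun i hi => Nat.pow_lt_pow_right Nat.one_lt_two hi
  -- initialisation
  have hinit : Exec w O (seq (op .add (.dir X) (.imm 1) (.imm 0)) (op .add (.dir W) (.imm 0) (.imm 0)))
      ⟨merge R H, qs⟩ ⟨merge (probeR R X W 0 w) H, qs⟩ (1 + 1) := by
    refine Exec.seq (Exec.op_dir' hX (v := 1) (BinOp.eval_add_eq rfl h1w))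
      ((Exec.op_dir' hW (v := 0) (BinOp.eval_add_eq rfl (by omega))).of_eq (store_merge_eq ?_ rfl))
    funext a
    simp only [probeR, Function.update_apply, pow_zero, Nat.mod_eq_of_lt h1w]
  -- one iteration (`i < w`)
  have hbody : ∀ i, i < w → Exec w O
      (seq (op .add (.dir X) (.dir X) (.dir X)) (op .add (.dir W) (.dir W) (.imm 1)))
      ⟨merge (probeR R X W i w) H, qs⟩ ⟨merge (probeR R X W (i + 1) w) H, qs⟩ (1 + 1) := by
    intro i hi
    refine Exec.seq (Exec.op_dir' hX (v := 2 ^ (i + 1) % 2 ^ w) ?_)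
      ((Exec.op_dir' hW (v := i + 1) ?_).of_eq (store_merge_eq ?_ rfl))
    · rw [Operand.read_dir, merge_apply_of_lt hX, probeR_X R hXW, Nat.mod_eq_of_lt (hpow i hi)]
      show (2 ^ i + 2 ^ i) % 2 ^ w = 2 ^ (i + 1) % 2 ^ w
      rw [pow_succ, Nat.mul_two]
    · rw [Operand.read_dir, Operand.read_imm, merge_apply_of_lt hW, Function.update_of_ne hXW.symm,
        probeR_W]
      exact BinOp.eval_add_eq rfl (by omega)
    · funext a
      simp only [probeR, Function.update_apply]
      split_ifs <;> rfl
  have hloop := Exec.whilenz_iter (w := w) (O := O) (x := .dir X)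
    (s := seq (op .add (.dir X) (.dir X) (.dir X)) (op .add (.dir W) (.dir W) (.imm 1))) w
    (fun i => ⟨merge (probeR R X W i w) H, qs⟩) (fun _ => 1 + 1)
    (fun i hi => by
      show (Operand.dir X).read (merge (probeR R X W i w) H) ≠ 0
      rw [Operand.read_dir_merge hX, probeR_X R hXW, Nat.mod_eq_of_lt (hpow i hi)]
      exact Nat.pos_iff_ne_zero.1 (Nat.two_pow_pos i))
    (by
      show (Operand.dir X).read (merge (probeR R X W w w) H) = 0
      rw [Operand.read_dir_merge hX, probeR_X R hXW, Nat.mod_self])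
    hbody
  have ht : 4 * w + 3 = (1 + 1) + (1 + ∑ i ∈ Finset.range w, (1 + 1 + 2)) := by
    rw [Finset.sum_const, Finset.card_range, smul_eq_mul]; omega
  rw [ht]
  exact Exec.seq hinit hloop

/-! ## Constant tables -/

/-- Write the literal words `vs` at the data address held in register `P`, advancing `P` past
them: for each `v`, `mem[P] := v; P := P + 1`. [folklore] -/
def writeConsts (P : ℕ) : List ℕ → SProg
  | [] => skip
  | v :: vs => seq (seq (op .add (.ind P) (.imm v) (.imm 0)) (op .add (.dir P) (.dir P) (.imm 1)))
      (writeConsts P vs)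

/-- `writeConsts` makes no oracle query. [folklore] -/
theorem writeConsts_queryFree (P : ℕ) : ∀ vs : List ℕ, (writeConsts P vs).QueryFree
  | [] => trivial
  | _ :: vs => ⟨⟨trivial, trivial⟩, writeConsts_queryFree P vs⟩

/-- The code length of `writeConsts`. [folklore] -/
@[simp] theorem len_writeConsts (P : ℕ) : ∀ vs : List ℕ, (writeConsts P vs).len = 2 * vs.length
  | [] => rfl
  | _ :: vs => by simp [writeConsts, len, len_writeConsts P vs]; omega

/-- The data after writing `vs` at `p`: `vs[i]` at `p + i`, the rest unchanged. [folklore] -/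
def tableH (H : ℕ → ℕ) (p : ℕ) (vs : List ℕ) : ℕ → ℕ := fun a =>
  if p ≤ a ∧ a < p + vs.length then vs.getD (a - p) 0 else H a

/-- Inside the table. [folklore] -/
theorem tableH_apply_add (H : ℕ → ℕ) (p : ℕ) (vs : List ℕ) {i : ℕ} (hi : i < vs.length) :
    tableH H p vs (p + i) = vs[i] := by
  simp only [tableH]
  rw [if_pos (by omega), Nat.add_sub_cancel_left, List.getD_eq_getElem _ _ hi]

/-- Outside the table. [folklore] -/
theorem tableH_apply_of_not (H : ℕ → ℕ) (p : ℕ) (vs : List ℕ) {a : ℕ} (ha : a < p ∨ p + vs.length ≤ a) :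
    tableH H p vs a = H a := by
  simp only [tableH]; rw [if_neg (by omega)]

/-- The empty table. [folklore] -/
theorem tableH_nil (H : ℕ → ℕ) (p : ℕ) : tableH H p [] = H := by
  funext a; simp [tableH]

/-- One more word in front: writing `v` at `p` and then `vs` from `p + 1`. [folklore] -/
theorem tableH_cons (H : ℕ → ℕ) (p v : ℕ) (vs : List ℕ) :
    tableH (Function.update H p v) (p + 1) vs = tableH H p (v :: vs) := by
  funext a
  simp only [tableH, List.length_cons]
  by_cases ha : a = p
  · subst ha
    rw [if_neg (by omega), if_pos (by omega), Function.update_self, Nat.sub_self]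
    rfl
  · rw [Function.update_of_ne ha]
    by_cases hin : p + 1 ≤ a ∧ a < p + 1 + vs.length
    · rw [if_pos hin, if_pos (by omega)]
      obtain ⟨i, rfl⟩ : ∃ i, a = p + (i + 1) := ⟨a - p - 1, by omega⟩
      rw [show p + (i + 1) - (p + 1) = i by omega, show p + (i + 1) - p = i + 1 by omega]
      rfl
    · rw [if_neg hin, if_neg (by omega)]

/-- **Semantics of `writeConsts`.** With a data address `p` in `P` (`p + |vs| < 2 ^ w`, all words
`< 2 ^ w`), `writeConsts P vs` ends after exactly `2 |vs|` steps with the table written at `p`,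
`P` advanced to `p + |vs|`, everything else unchanged. [folklore] -/
theorem writeConsts_exec {P : ℕ} (hP : P < 100) :
    ∀ (vs : List ℕ) {R H : ℕ → ℕ} {p : ℕ}, R P = p → 100 ≤ p → p + vs.length < 2 ^ w →
      (∀ v ∈ vs, v < 2 ^ w) → ∀ qs : List (List ℕ),
      Exec w O (writeConsts P vs) ⟨merge R H, qs⟩
        ⟨merge (Function.update R P (p + vs.length)) (tableH H p vs), qs⟩ (2 * vs.length)
  | [], R, H, p, hRp, hp, hw, hv, qs => by
    have hS : R = Function.update R P (p + ([] : List ℕ).length) := by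
      rw [List.length_nil, Nat.add_zero, ← hRp, Function.update_eq_self]
    exact (Exec.skip (w := w) (O := O) ⟨merge R H, qs⟩).of_eq
      (store_merge_eq hS (tableH_nil H p).symm)
  | v :: vs, R, H, p, hRp, hp, hw, hv, qs => by
    have hvw : v < 2 ^ w := hv v (by simp)
    have hlen : (v :: vs).length = vs.length + 1 := rfl
    -- the two instructions for `v`
    have h1 : Exec w O (op .add (.ind P) (.imm v) (.imm 0)) ⟨merge R H, qs⟩
        ⟨merge R (Function.update H p v), qs⟩ 1 :=
      Exec.op_ind' hP hRp hp (BinOp.eval_add_eq rfl hvw)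
    have h2 : Exec w O (op .add (.dir P) (.dir P) (.imm 1)) ⟨merge R (Function.update H p v), qs⟩
        ⟨merge (Function.update R P (p + 1)) (Function.update H p v), qs⟩ 1 :=
      Exec.op_dir' hP (by
        rw [Operand.read_dir, Operand.read_imm, merge_apply_of_lt hP, hRp]
        exact BinOp.eval_add_eq rfl (by omega))
    -- the rest, from the advanced pointer
    have h3 := writeConsts_exec hP vs (R := Function.update R P (p + 1)) (H := Function.update H p v)
      (p := p + 1) (by simp) (by omega) (by omega) (fun u hu => hv u (List.mem_cons_of_mem v hu)) qs
    have hS : Function.update (Function.update R P (p + 1)) P (p + 1 + vs.length) =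
        Function.update R P (p + (v :: vs).length) := by
      rw [Function.update_idem, hlen, Nat.add_assoc, Nat.add_comm 1]
    rw [store_merge_eq hS (tableH_cons H p v vs)] at h3
    have ht : 2 * (v :: vs).length = 1 + 1 + 2 * vs.length := by rw [hlen]; omega
    rw [ht]
    exact Exec.seq (Exec.seq h1 h2) h3

/-! ## The output word -/

/-- Make the output the one-word list `[R A]`: `mem[0] := 1; mem[1] := R A`. [folklore] -/
def output1 (A : ℕ) : SProg :=
  seq (op .add (.dir 0) (.imm 1) (.imm 0)) (op .add (.dir 1) (.dir A) (.imm 0))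

/-- `output1` makes no oracle query. [folklore] -/
theorem output1_queryFree (A : ℕ) : (output1 A).QueryFree := ⟨trivial, trivial⟩

/-- **Semantics of `output1`** (`A ≥ 2` a register holding a word): two steps, after which cell `0`
holds `1` and cell `1` holds `R A`. [folklore] -/
theorem output1_exec {A : ℕ} (hA : A < 100) (hA2 : 2 ≤ A) {R H : ℕ → ℕ} (hw : 1 ≤ w)
    (hv : R A < 2 ^ w) (qs : List (List ℕ)) :
    Exec w O (output1 A) ⟨merge R H, qs⟩
      ⟨merge (Function.update (Function.update R 0 1) 1 (R A)) H, qs⟩ (1 + 1) := by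
  have h1w : 1 < 2 ^ w := Nat.one_lt_two_pow (by omega)
  refine Exec.seq (Exec.op_dir' (by norm_num) (v := 1) (BinOp.eval_add_eq rfl h1w))
    (Exec.op_dir' (by norm_num) (v := R A) ?_)
  rw [Operand.read_dir, Operand.read_imm, merge_apply_of_lt hA, Function.update_of_ne (by omega)]
  exact BinOp.eval_add_eq rfl hv

/-- The output read back after `output1`. [folklore] -/
theorem readOut_output1 (R H : ℕ → ℕ) (A : ℕ) :
    readOut (merge (Function.update (Function.update R 0 1) 1 (R A)) H) = [R A] := by
  simp [readOut, readSeg, merge]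

end SProg

end Literature.Computability.Cryptography.WordRAM
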